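import Summits.QuantumFields.YangMills.Theorems.BalabanLadderNTReferenceMarginsThreePoint
import Summits.QuantumFields.YangMills.Theorems.BalabanLadderNTReferenceTorusPackage
import HarnessLib

/-!
# Crux `NT` (stmt-QuantumFields-19353): the MARGINS of `RefPkgT` are β-UNIFORM NUMBERS, III — the periodic reference
# package with PLAIN floors: `LowerBounds` and `BalabanLadder.NT` by name

Helper file (`--supports stmt-QuantumFields-19353`) of the fleet lead prover of crux `NT` (unit `ym-spine-19353-p1`,
g11); third of three (sequel of `…NTReferenceMargins`, `…NTReferenceMarginsThreePoint`).  The tree's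
`Reference.lowerBounds_fst/snd_of_torusReference` and `Reference.nt_of_torusReferencePackage` (g4; = the registered
`RefPkgT` ⇒ `NT`) take the floors WITH the β-dependent margins `M₂(β)`, `M₃(β)`; by `refMargin₂_le` / `refMargin₃_le`
these are bounded by NUMBERS fixed before `β`, so the package re-types with PLAIN floors:

* **`lowerBounds_fst_of_torusReference_plain`** — E1/E2-osc + ONE positive-time witness `v` (time gap `δ`, envelopes
  `K_θ, K_v`) with `ε + K_θK_v(2C₁²/κ⁸ + C₂/(κ⁴(2δ)⁴)) ≤ Q2 G r β (L₀ β) (a β) (θv) v` on one torus per coupling ⇒ clause (i)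
  of `LowerBounds` on every torus;
* **`lowerBounds_snd_of_torusReference_plain`** — E1/E2/E3-osc + a pairwise-`δ`-separated triple with
  `ε + K_fK_gK_h(6C₁C₂/(κ⁸δ⁴) + 2C₁³/κ¹² + C₃/(κ⁴δ⁸)) ≤ |Q3 G r β (L₀ β) (a β) f g h|` ⇒ clause (ii) on every torus;
* **`nt_of_torusReferencePackage_plain`** — `BalabanLadder.NT` BY NAME from the package with plain floors.

The extra data (`δ`, the envelopes) exist for every admissible witness (`exists_timeGap_envelopes`,
`exists_sep_envelopes`), so nothing is lost against the registered text; what is gained is that the engine's floor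
targets are two NUMBERS: `ε₄ > K_θK_v(2C₁²κ⁻⁸ + C₂κ⁻⁴(2δ)⁻⁴)` and `ε₅ > K_fK_gK_h(6C₁C₂κ⁻⁸δ⁻⁴ + 2C₁³κ⁻¹² + C₃κ⁻⁴δ⁻⁸)`.

HONEST FRAMING.  Bookkeeping over the tree's transfer theorems; every floor and ceiling is engine-grade OPEN
(PerturbativeInvisibility); not a floor, not AF, not NT, not the seam, not the gap; not Clay.
-/

set_option autoImplicit false

noncomputable section

open scoped SchwartzMap
open MeasureTheory Filter Topology Finset
open Literature.MathematicalPhysics.QuantumFieldTheory Literature.MathematicalPhysics.QuantumLattice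
open Literature.Probability.LatticeModels
open Summit.QuantumFields.YangMills.Cruxes.OSLegsFromFemtoAndGap.DlrCollarTransfer
open Summit.QuantumFields.YangMills.Cruxes.IR.AfOnset (exists_sum_abs_schwartz_lattice_le_div_min
  thetaTest_apply_eq_zero_of_tsupport_subset apply_eq_zero_of_tsupport_subset)

namespace Summit.QuantumFields.YangMills.Cruxes.NT.Reference

/-! ## §4 The package with PLAIN floors: `LowerBounds` and `BalabanLadder.NT` by name -/

section Package

variable (G : Type) [Group G] [TopologicalSpace G] [IsTopologicalGroup G] [CompactSpace G]
  [MeasurableSpace G] [BorelSpace G] (r : LatticeRep G)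

/-- Eventually `a β ≤ 1` along a vanishing positive unit map. [folklore] -/
theorem eventually_le_one_of_tendsto {a : ℝ → ℝ} (ha : Tendsto a atTop (𝓝 0)) : ∃ β₀ : ℝ, ∀ β : ℝ, β₀ ≤ β → a β ≤ 1 := by
  have hev : ∀ᶠ β in atTop, a β < 1 := ha.eventually (gt_mem_nhds one_pos)
  obtain ⟨β₀, h⟩ := Filter.eventually_atTop.1 hev
  exact ⟨β₀, fun β hβ => (h β hβ).le⟩

/-- **Clause (i) of `LowerBounds` on EVERY torus from E1/E2-osc and a PLAIN two-point floor clearing the number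
`K_θ K_v (2C₁²/κ⁸ + C₂/(κ⁴(2δ)⁴))` on one torus per coupling** (the tree's `lowerBounds_fst_of_torusReference` with its
margin hypothesis discharged by `refMargin₂_le`). [folklore] -/
theorem lowerBounds_fst_of_torusReference_plain (a : ℝ → ℝ) (ha₀ : ∀ β, 0 < a β) (ha : Tendsto a atTop (𝓝 0))
    {C₁ C₂ ℓ σ κ : ℝ} (hC₁ : 0 ≤ C₁) (hC₂ : 0 ≤ C₂) (hσ : 0 < σ) (hκ : 0 < κ) (hℓ : 2 * (σ + κ) < ℓ)
    (hE1 : ∃ β₁ : ℝ, ∀ β : ℝ, β₁ ≤ β → ∀ (c : Fin 4 → ℤ) (b : ℕ), (b : ℝ) * a β ≤ ℓ →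
      ∀ (η η' : LGConfig 4 G) (x : Fin 4 → ℤ), 1 ≤ depth c b x →
        |kerE G r β c b η (dens G r x) - kerE G r β c b η' (dens G r x)| ≤ C₁ / (depth c b x : ℝ) ^ 4)
    (hE2 : ∃ β₂ : ℝ, ∀ β : ℝ, β₂ ≤ β → ∀ (c : Fin 4 → ℤ) (b : ℕ), (b : ℝ) * a β ≤ ℓ →
      ∀ (η η' : LGConfig 4 G) (x y : Fin 4 → ℤ), 1 ≤ depth c b x → 1 ≤ depth c b y →
        |kerCov G r β c b η (dens G r x) (dens G r y) - kerCov G r β c b η' (dens G r x) (dens G r y)| ≤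
          C₂ / ((min (depth c b x) (depth c b y) : ℕ) : ℝ) ^ 4 / (1 + ‖siteToE (y - x)‖) ^ 4)
    (hR2 : ∃ (v : 𝓢(EuclideanSpace ℝ (Fin 4), ℝ)) (ε β₅ δ Kθ Kv : ℝ) (L₀ : ℝ → ℕ),
      tsupport (v : EuclideanSpace ℝ (Fin 4) → ℝ) ⊆ {y | 0 < y 0} ∧
      tsupport (v : EuclideanSpace ℝ (Fin 4) → ℝ) ⊆ Metric.closedBall 0 σ ∧ 0 < ε ∧ 0 < δ ∧
      (∀ y : EuclideanSpace ℝ (Fin 4), v y ≠ 0 → δ ≤ y 0) ∧ 0 ≤ Kθ ∧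
      (∀ s : ℝ, 0 < s → s ≤ 1 → ∀ Λ : Finset (Fin 4 → ℤ), ∑ x ∈ Λ, |thetaTest 4 v (s • siteToE x)| ≤ Kθ / s ^ 4) ∧
      (∀ s : ℝ, 0 < s → s ≤ 1 → ∀ Λ : Finset (Fin 4 → ℤ), ∑ y ∈ Λ, |v (s • siteToE y)| ≤ Kv / s ^ 4) ∧
      ∀ β : ℝ, β₅ ≤ β → σ + κ + 1 ≤ a β * L₀ β ∧
        ε + Kθ * Kv * (2 * C₁ ^ 2 / κ ^ 8 + C₂ / (κ ^ 4 * (2 * δ) ^ 4)) ≤ Q2 G r β (L₀ β) (a β) (thetaTest 4 v) v) :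
    ∃ (v : 𝓢(EuclideanSpace ℝ (Fin 4), ℝ)) (ε β₅ Λ₅ : ℝ),
      tsupport (v : EuclideanSpace ℝ (Fin 4) → ℝ) ⊆ {y : EuclideanSpace ℝ (Fin 4) | 0 < y 0} ∧ 0 < ε ∧
      ∀ β : ℝ, β₅ ≤ β → ∀ L : ℕ, Λ₅ ≤ a β * L → ε ≤ Q2 G r β L (a β) (thetaTest 4 v) v := by
  obtain ⟨v, ε, β₅, δ, Kθ, Kv, L₀, hv, hvσ, hε, hδ, hvδ, hKθ0, hKθ, hKv, hR⟩ := hR2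
  obtain ⟨β₀, hβ₀⟩ := eventually_le_one_of_tendsto ha
  refine lowerBounds_fst_of_torusReference G r a ha₀ ha hC₁ hC₂ hσ hκ hℓ hE1 hE2
    ⟨v, ε, max β₅ β₀, L₀, hv, hvσ, hε, fun β hβ => ?_⟩
  obtain ⟨hfit, hfl⟩ := hR β (le_trans (le_max_left _ _) hβ)
  refine ⟨hfit, le_trans ?_ hfl⟩
  have hm := refMargin₂_le (C₁ := C₁) hδ hvδ hKθ0 hKθ hKv hC₂ hκ (ha₀ β) (hβ₀ β (le_trans (le_max_right _ _) hβ)) (box 4 (L₀ β))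
  linarith

/-- **Clause (ii) of `LowerBounds` on EVERY torus from E1/E2/E3-osc and a PLAIN three-point floor clearing the number
`K_f K_g K_h (6C₁C₂/(κ⁸δ⁴) + 2C₁³/κ¹² + C₃/(κ⁴δ⁸))` on one torus per coupling** (the tree's `lowerBounds_snd_of_torusReference`
with its margin hypothesis discharged by `refMargin₃_le`). [folklore] -/
theorem lowerBounds_snd_of_torusReference_plain (a : ℝ → ℝ) (ha₀ : ∀ β, 0 < a β) (ha : Tendsto a atTop (𝓝 0))
    {C₁ C₂ C₃ ℓ σ κ : ℝ} (hC₁ : 0 ≤ C₁) (hC₂ : 0 ≤ C₂) (hC₃ : 0 ≤ C₃) (hσ : 0 < σ) (hκ : 0 < κ)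
    (hℓ : 2 * (σ + κ) < ℓ)
    (hE1 : ∃ β₁ : ℝ, ∀ β : ℝ, β₁ ≤ β → ∀ (c : Fin 4 → ℤ) (b : ℕ), (b : ℝ) * a β ≤ ℓ →
      ∀ (η η' : LGConfig 4 G) (x : Fin 4 → ℤ), 1 ≤ depth c b x →
        |kerE G r β c b η (dens G r x) - kerE G r β c b η' (dens G r x)| ≤ C₁ / (depth c b x : ℝ) ^ 4)
    (hE2 : ∃ β₂ : ℝ, ∀ β : ℝ, β₂ ≤ β → ∀ (c : Fin 4 → ℤ) (b : ℕ), (b : ℝ) * a β ≤ ℓ →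
      ∀ (η η' : LGConfig 4 G) (x y : Fin 4 → ℤ), 1 ≤ depth c b x → 1 ≤ depth c b y →
        |kerCov G r β c b η (dens G r x) (dens G r y) - kerCov G r β c b η' (dens G r x) (dens G r y)| ≤
          C₂ / ((min (depth c b x) (depth c b y) : ℕ) : ℝ) ^ 4 / (1 + ‖siteToE (y - x)‖) ^ 4)
    (hE3 : ∃ β₃ : ℝ, ∀ β : ℝ, β₃ ≤ β → ∀ (c : Fin 4 → ℤ) (b : ℕ), (b : ℝ) * a β ≤ ℓ →
      ∀ (η η' : LGConfig 4 G) (x y z : Fin 4 → ℤ), 1 ≤ depth c b x → 1 ≤ depth c b y → 1 ≤ depth c b z →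
        |kerK3 G r β c b η x y z - kerK3 G r β c b η' x y z| ≤
          C₃ / ((min (min (depth c b x) (depth c b y)) (depth c b z) : ℕ) : ℝ) ^ 4 /
            (1 + min (min ‖siteToE (y - x)‖ ‖siteToE (z - y)‖) ‖siteToE (z - x)‖) ^ 8)
    (hR3 : ∃ (f g h : 𝓢(EuclideanSpace ℝ (Fin 4), ℝ)) (ε β₅ δ Kf Kg Kh : ℝ) (L₀ : ℝ → ℕ),
      Disjoint (tsupport (f : EuclideanSpace ℝ (Fin 4) → ℝ)) (tsupport (g : EuclideanSpace ℝ (Fin 4) → ℝ)) ∧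
      Disjoint (tsupport (g : EuclideanSpace ℝ (Fin 4) → ℝ)) (tsupport (h : EuclideanSpace ℝ (Fin 4) → ℝ)) ∧
      Disjoint (tsupport (f : EuclideanSpace ℝ (Fin 4) → ℝ)) (tsupport (h : EuclideanSpace ℝ (Fin 4) → ℝ)) ∧
      tsupport (f : EuclideanSpace ℝ (Fin 4) → ℝ) ⊆ Metric.closedBall 0 σ ∧
      tsupport (g : EuclideanSpace ℝ (Fin 4) → ℝ) ⊆ Metric.closedBall 0 σ ∧
      tsupport (h : EuclideanSpace ℝ (Fin 4) → ℝ) ⊆ Metric.closedBall 0 σ ∧ 0 < ε ∧ 0 < δ ∧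
      (∀ p q : EuclideanSpace ℝ (Fin 4), f p ≠ 0 → g q ≠ 0 → δ ≤ ‖p - q‖) ∧
      (∀ p q : EuclideanSpace ℝ (Fin 4), g p ≠ 0 → h q ≠ 0 → δ ≤ ‖p - q‖) ∧
      (∀ p q : EuclideanSpace ℝ (Fin 4), f p ≠ 0 → h q ≠ 0 → δ ≤ ‖p - q‖) ∧ 0 ≤ Kf ∧ 0 ≤ Kg ∧
      (∀ s : ℝ, 0 < s → s ≤ 1 → ∀ Λ : Finset (Fin 4 → ℤ), ∑ x ∈ Λ, |f (s • siteToE x)| ≤ Kf / s ^ 4) ∧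
      (∀ s : ℝ, 0 < s → s ≤ 1 → ∀ Λ : Finset (Fin 4 → ℤ), ∑ y ∈ Λ, |g (s • siteToE y)| ≤ Kg / s ^ 4) ∧
      (∀ s : ℝ, 0 < s → s ≤ 1 → ∀ Λ : Finset (Fin 4 → ℤ), ∑ z ∈ Λ, |h (s • siteToE z)| ≤ Kh / s ^ 4) ∧
      ∀ β : ℝ, β₅ ≤ β → σ + κ + 1 ≤ a β * L₀ β ∧
        ε + Kf * Kg * Kh * (6 * C₁ * C₂ / (κ ^ 8 * δ ^ 4) + 2 * C₁ ^ 3 / κ ^ 12 + C₃ / (κ ^ 4 * δ ^ 8)) ≤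
          |Q3 G r β (L₀ β) (a β) f g h|) :
    ∃ (f g h : 𝓢(EuclideanSpace ℝ (Fin 4), ℝ)) (ε β₅ Λ₅ : ℝ),
      Disjoint (tsupport (f : EuclideanSpace ℝ (Fin 4) → ℝ)) (tsupport (g : EuclideanSpace ℝ (Fin 4) → ℝ)) ∧
      Disjoint (tsupport (g : EuclideanSpace ℝ (Fin 4) → ℝ)) (tsupport (h : EuclideanSpace ℝ (Fin 4) → ℝ)) ∧
      Disjoint (tsupport (f : EuclideanSpace ℝ (Fin 4) → ℝ)) (tsupport (h : EuclideanSpace ℝ (Fin 4) → ℝ)) ∧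
      0 < ε ∧ ∀ β : ℝ, β₅ ≤ β → ∀ L : ℕ, Λ₅ ≤ a β * L → ε ≤ |Q3 G r β L (a β) f g h| := by
  obtain ⟨f, g, h, ε, β₅, δ, Kf, Kg, Kh, L₀, hfg, hgh, hfh, hfσ, hgσ, hhσ, hε, hδ, h₁, h₂, h₃, hKf0, hKg0, hKf, hKg, hKh,
    hR⟩ := hR3
  obtain ⟨β₀, hβ₀⟩ := eventually_le_one_of_tendsto ha
  refine lowerBounds_snd_of_torusReference G r a ha₀ ha hC₁ hC₂ hC₃ hσ hκ hℓ hE1 hE2 hE3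
    ⟨f, g, h, ε, max β₅ β₀, L₀, hfg, hgh, hfh, hfσ, hgσ, hhσ, hε, fun β hβ => ?_⟩
  obtain ⟨hfit, hfl⟩ := hR β (le_trans (le_max_left _ _) hβ)
  refine ⟨hfit, le_trans ?_ hfl⟩
  have hm := refMargin₃_le hδ h₁ h₂ h₃ hKf0 hKg0 hKf hKg hKh hC₁ hC₂ hC₃ hκ (ha₀ β)
    (hβ₀ β (le_trans (le_max_right _ _) hβ)) (box 4 (L₀ β))
  linarith

end Package

/-- **`BalabanLadder.NT` BY NAME from the periodic reference package with PLAIN floors** — for every compact simple `G`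
one `(r, a)` (`0 < a`, `a → 0`), constants `C₁, C₂, C₃ ≥ 0`, a femto scale `ℓ`, a support radius `σ > 0` and a collar
`κ > 0` (`2(σ+κ) < ℓ`), the three exterior-oscillation ceilings on femto cubes, and — on ONE torus per coupling — a
two-point floor `ε + K_θK_v(2C₁²/κ⁸ + C₂/(κ⁴(2δ)⁴)) ≤ Q2(θv, v)` for a positive-time witness `v` with time gap `δ` and
ℓ¹-envelopes `K_θ, K_v`, and a three-point floor `ε + K_fK_gK_h(6C₁C₂/(κ⁸δ⁴) + 2C₁³/κ¹² + C₃/(κ⁴δ⁸)) ≤ |Q3(f, g, h)|` for a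
pairwise-`δ`-separated triple with envelopes `K_f, K_g, K_h` (the registered margins replaced by NUMBERS fixed before `β`).
[folklore] -/
theorem nt_of_torusReferencePackage_plain
    (h : ∀ (G : Type) [Group G] [TopologicalSpace G] [IsTopologicalGroup G] [CompactSpace G],
      IsCompactSimpleLieGroup G → letI : MeasurableSpace G := borel G; haveI : BorelSpace G := ⟨rfl⟩;
      ∃ (r : LatticeRep G) (a : ℝ → ℝ), (∀ β, 0 < a β) ∧ Tendsto a atTop (𝓝 0) ∧
      ∃ (C₁ C₂ C₃ ℓ σ κ : ℝ), 0 ≤ C₁ ∧ 0 ≤ C₂ ∧ 0 ≤ C₃ ∧ 0 < σ ∧ 0 < κ ∧ 2 * (σ + κ) < ℓ ∧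
      (∃ β₁ : ℝ, ∀ β : ℝ, β₁ ≤ β → ∀ (c : Fin 4 → ℤ) (b : ℕ), (b : ℝ) * a β ≤ ℓ →
        ∀ (η η' : LGConfig 4 G) (x : Fin 4 → ℤ), 1 ≤ depth c b x →
          |kerE G r β c b η (dens G r x) - kerE G r β c b η' (dens G r x)| ≤ C₁ / (depth c b x : ℝ) ^ 4) ∧
      (∃ β₂ : ℝ, ∀ β : ℝ, β₂ ≤ β → ∀ (c : Fin 4 → ℤ) (b : ℕ), (b : ℝ) * a β ≤ ℓ →
        ∀ (η η' : LGConfig 4 G) (x y : Fin 4 → ℤ), 1 ≤ depth c b x → 1 ≤ depth c b y →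
          |kerCov G r β c b η (dens G r x) (dens G r y) - kerCov G r β c b η' (dens G r x) (dens G r y)| ≤
            C₂ / ((min (depth c b x) (depth c b y) : ℕ) : ℝ) ^ 4 / (1 + ‖siteToE (y - x)‖) ^ 4) ∧
      (∃ β₃ : ℝ, ∀ β : ℝ, β₃ ≤ β → ∀ (c : Fin 4 → ℤ) (b : ℕ), (b : ℝ) * a β ≤ ℓ →
        ∀ (η η' : LGConfig 4 G) (x y z : Fin 4 → ℤ), 1 ≤ depth c b x → 1 ≤ depth c b y → 1 ≤ depth c b z →
          |kerK3 G r β c b η x y z - kerK3 G r β c b η' x y z| ≤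
            C₃ / ((min (min (depth c b x) (depth c b y)) (depth c b z) : ℕ) : ℝ) ^ 4 /
              (1 + min (min ‖siteToE (y - x)‖ ‖siteToE (z - y)‖) ‖siteToE (z - x)‖) ^ 8) ∧
      (∃ (v : 𝓢(EuclideanSpace ℝ (Fin 4), ℝ)) (ε β₅ δ Kθ Kv : ℝ) (L₀ : ℝ → ℕ),
        tsupport (v : EuclideanSpace ℝ (Fin 4) → ℝ) ⊆ {y | 0 < y 0} ∧
        tsupport (v : EuclideanSpace ℝ (Fin 4) → ℝ) ⊆ Metric.closedBall 0 σ ∧ 0 < ε ∧ 0 < δ ∧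
        (∀ y : EuclideanSpace ℝ (Fin 4), v y ≠ 0 → δ ≤ y 0) ∧ 0 ≤ Kθ ∧
        (∀ s : ℝ, 0 < s → s ≤ 1 → ∀ Λ : Finset (Fin 4 → ℤ), ∑ x ∈ Λ, |thetaTest 4 v (s • siteToE x)| ≤ Kθ / s ^ 4) ∧
        (∀ s : ℝ, 0 < s → s ≤ 1 → ∀ Λ : Finset (Fin 4 → ℤ), ∑ y ∈ Λ, |v (s • siteToE y)| ≤ Kv / s ^ 4) ∧
        ∀ β : ℝ, β₅ ≤ β → σ + κ + 1 ≤ a β * L₀ β ∧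
          ε + Kθ * Kv * (2 * C₁ ^ 2 / κ ^ 8 + C₂ / (κ ^ 4 * (2 * δ) ^ 4)) ≤ Q2 G r β (L₀ β) (a β) (thetaTest 4 v) v) ∧
      (∃ (f g h : 𝓢(EuclideanSpace ℝ (Fin 4), ℝ)) (ε β₅ δ Kf Kg Kh : ℝ) (L₀ : ℝ → ℕ),
        Disjoint (tsupport (f : EuclideanSpace ℝ (Fin 4) → ℝ)) (tsupport (g : EuclideanSpace ℝ (Fin 4) → ℝ)) ∧
        Disjoint (tsupport (g : EuclideanSpace ℝ (Fin 4) → ℝ)) (tsupport (h : EuclideanSpace ℝ (Fin 4) → ℝ)) ∧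
        Disjoint (tsupport (f : EuclideanSpace ℝ (Fin 4) → ℝ)) (tsupport (h : EuclideanSpace ℝ (Fin 4) → ℝ)) ∧
        tsupport (f : EuclideanSpace ℝ (Fin 4) → ℝ) ⊆ Metric.closedBall 0 σ ∧
        tsupport (g : EuclideanSpace ℝ (Fin 4) → ℝ) ⊆ Metric.closedBall 0 σ ∧
        tsupport (h : EuclideanSpace ℝ (Fin 4) → ℝ) ⊆ Metric.closedBall 0 σ ∧ 0 < ε ∧ 0 < δ ∧
        (∀ p q : EuclideanSpace ℝ (Fin 4), f p ≠ 0 → g q ≠ 0 → δ ≤ ‖p - q‖) ∧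
        (∀ p q : EuclideanSpace ℝ (Fin 4), g p ≠ 0 → h q ≠ 0 → δ ≤ ‖p - q‖) ∧
        (∀ p q : EuclideanSpace ℝ (Fin 4), f p ≠ 0 → h q ≠ 0 → δ ≤ ‖p - q‖) ∧ 0 ≤ Kf ∧ 0 ≤ Kg ∧
        (∀ s : ℝ, 0 < s → s ≤ 1 → ∀ Λ : Finset (Fin 4 → ℤ), ∑ x ∈ Λ, |f (s • siteToE x)| ≤ Kf / s ^ 4) ∧
        (∀ s : ℝ, 0 < s → s ≤ 1 → ∀ Λ : Finset (Fin 4 → ℤ), ∑ y ∈ Λ, |g (s • siteToE y)| ≤ Kg / s ^ 4) ∧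
        (∀ s : ℝ, 0 < s → s ≤ 1 → ∀ Λ : Finset (Fin 4 → ℤ), ∑ z ∈ Λ, |h (s • siteToE z)| ≤ Kh / s ^ 4) ∧
        ∀ β : ℝ, β₅ ≤ β → σ + κ + 1 ≤ a β * L₀ β ∧
          ε + Kf * Kg * Kh * (6 * C₁ * C₂ / (κ ^ 8 * δ ^ 4) + 2 * C₁ ^ 3 / κ ^ 12 + C₃ / (κ ^ 4 * δ ^ 8)) ≤
            |Q3 G r β (L₀ β) (a β) f g h|)) :
    Summit.QuantumFields.YangMills.Theses.BalabanLadder.NT := by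
  intro G _ _ _ _ hG
  letI : MeasurableSpace G := borel G
  haveI : BorelSpace G := ⟨rfl⟩
  obtain ⟨r, a, ha₀, ha, C₁, C₂, C₃, ℓ, σ, κ, hC₁, hC₂, hC₃, hσ, hκ, hℓ, hE1, hE2, hE3, hR2, hR3⟩ := h G hG
  exact ⟨r, a, ha₀, ha, lowerBounds_fst_of_torusReference_plain G r a ha₀ ha hC₁ hC₂ hσ hκ hℓ hE1 hE2 hR2,
    lowerBounds_snd_of_torusReference_plain G r a ha₀ ha hC₁ hC₂ hC₃ hσ hκ hℓ hE1 hE2 hE3 hR3⟩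


end Summit.QuantumFields.YangMills.Cruxes.NT.Reference

end
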